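import Literature.NumberTheory.EllipticCurves.Tamagawa
import HarnessLib

/-!
# Discharge of `WeierstrassCurve.localTamagawaNumber_eq_one_of_hasGoodReduction`: good reduction gives `c = 1`

D-0014 keeps `Literature/` sorry-free by stating cited results as named facts `def X : Prop`.
This sibling file of `Literature.NumberTheory.EllipticCurves.Tamagawa` proves, as
`theorem X_holds : X`, the named fact
`WeierstrassCurve.localTamagawaNumber_eq_one_of_hasGoodReduction`: for a discrete valuation ring
`R` with fraction field `K` and a Weierstrass curve `W / K` whose `R`-minimal model has good
reduction, the local Tamagawa number `c(W/K) = [E(K) : E₀(K)]` equals `1`.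

The printed argument (Silverman, *The Arithmetic of Elliptic Curves*, 2nd ed., VII.2, remark
after the proof of Prop. 2.1, p. 190): "if `v(Δ) = 0`, so `Δ̃ ≠ 0`, then `Ẽ` is nonsingular, so
`Ẽ_ns = Ẽ` and `E₀(K) = E(K)`". Equivalently this is Step 1 of Tate's algorithm (reduction type
`I₀`: `v(Δ) = 0`, `m = 1`, `f = 0`, `c = 1`; Silverman, *Advanced Topics in the Arithmetic of
Elliptic Curves*, IV.9, algorithm 9.4, Step 1, following Tate, *Algorithm for determining the
type of a singular fiber in an elliptic pencil*, LNM 476 (1975)).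

In Lean: Mathlib's `WeierstrassCurve.hasGoodReduction_iff_isElliptic_reduction` says that the
reduction of a minimal equation with good reduction is an elliptic curve over the residue field,
and `WeierstrassCurve.Affine.equation_iff_nonsingular` that every point of an elliptic curve is
nonsingular. The one step not spelled out in print is that an affine point `(x, y)` of an
integral equation with `x ∈ R` has `y ∈ R`: `y` is a root of the monic quadratic
`Y² + (a₁x + a₃)Y − (x³ + a₂x² + a₄x + a₆) ∈ R[Y]` and a discrete valuation ring is integrally
closed (`IsIntegrallyClosed.isIntegral_iff`). Hence every point has nonsingular reduction
(`WeierstrassCurve.isNonsingularReductionPoint_of_hasGoodReduction`), so `E₀(K) = ⊤`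
(`WeierstrassCurve.goodReductionSubgroup_eq_top_of_hasGoodReduction`) and the index is `1`
(`WeierstrassCurve.localTamagawaNumber_eq_one_of_hasGoodReduction_holds`).

All declarations are in `namespace WeierstrassCurve`, as deliberate dot-notation extensions next
to the definitions of `Tamagawa.lean`.

## References

* J. H. Silverman, *The Arithmetic of Elliptic Curves*, 2nd ed., GTM 106, Springer (2009),
  VII.2, Prop. 2.1 and the remark following its proof (p. 190). [SilvermanAEC2009]
* J. H. Silverman, *Advanced Topics in the Arithmetic of Elliptic Curves*, GTM 151, Springer
  (1994), IV.9, Tate's algorithm 9.4, Step 1. [SilvermanATAEC1994]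
* J. Tate, *Algorithm for determining the type of a singular fiber in an elliptic pencil*, in
  Modular Functions of One Variable IV, LNM 476, Springer (1975), 33–52. [TateLNM476]
-/

noncomputable section

open scoped Classical
open Polynomial

namespace WeierstrassCurve

section Local

variable (R : Type*) [CommRing R] [IsDomain R] [IsDiscreteValuationRing R] {K : Type*}
  [Field K] [Algebra R K] [IsFractionRing R K] (W : WeierstrassCurve K)

/-- On a minimal Weierstrass equation with good reduction (`v(Δ) = 0`) every `K`-rational point
has nonsingular reduction: the reduced curve `Ẽ` is nonsingular, so `Ẽ_ns = Ẽ`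
(Silverman, *AEC*, VII.2, remark after the proof of Prop. 2.1). The proof also checks that an
affine point `(x, y)` with `x ∈ R` has `y ∈ R` (root of a monic quadratic over the integrally
closed ring `R`) and that its reduction lies on `W.reduction R`.
[cite: SilvermanAEC2009, VII.2, remark after Prop. 2.1, p. 190] -/
theorem isNonsingularReductionPoint_of_hasGoodReduction [W.HasGoodReduction R]
    (P : W.toAffine.Point) : W.IsNonsingularReductionPoint R P := by
  rcases P with _ | ⟨x, y, h⟩
  · trivial
  · by_cases hx : x ∈ Set.range (algebraMap R K)
    · refine Or.inr ?_
      obtain ⟨x₀, rfl⟩ := hx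
      set I : WeierstrassCurve R := W.integralModel R with hIdef
      have hIW : I.map (algebraMap R K) = W := baseChange_integralModel_eq R W
      -- the affine equation of `W` at `(x, y)`, written with the coefficients of the integral model
      have heq : y ^ 2 + algebraMap R K I.a₁ * algebraMap R K x₀ * y + algebraMap R K I.a₃ * y =
          algebraMap R K x₀ ^ 3 + algebraMap R K I.a₂ * algebraMap R K x₀ ^ 2 +
            algebraMap R K I.a₄ * algebraMap R K x₀ + algebraMap R K I.a₆ := by
        have := (Affine.equation_iff ..).mp h.left
        rwa [← hIW] at this
      -- `y` is a root of a monic quadratic over `R`, hence lies in `R` (`R` is integrally closed)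
      have hy : _root_.IsIntegral R y := by
        refine ⟨X ^ 2 + C (I.a₁ * x₀ + I.a₃) * X - C (x₀ ^ 3 + I.a₂ * x₀ ^ 2 + I.a₄ * x₀ + I.a₆),
          ?_, ?_⟩
        · monicity!
        · simp only [eval₂_sub, eval₂_add, eval₂_mul, eval₂_X_pow, eval₂_X, eval₂_C]
          simp only [map_add, map_mul, map_pow]
          linear_combination heq
      obtain ⟨y₀, rfl⟩ := IsIntegrallyClosed.isIntegral_iff.mp hy
      refine ⟨x₀, y₀, rfl, rfl, ?_⟩
      -- good reduction: the reduced curve is elliptic, so every point on it is nonsingular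
      haveI : (W.reduction R).IsElliptic := (hasGoodReduction_iff_isElliptic_reduction R).mp ‹_›
      refine Affine.equation_iff_nonsingular.mp ?_
      -- the integral point `(x₀, y₀)` lies on the integral model, hence reduces onto the reduction
      have hI : I.toAffine.Equation x₀ y₀ := by
        rw [← Affine.map_equation _ (IsFractionRing.injective R K)]
        change (I.map (algebraMap R K)).toAffine.Equation _ _
        rw [hIW]
        exact h.left
      exact hI.map (IsLocalRing.residue R)
    · exact Or.inl hx

/-- For a minimal Weierstrass equation with good reduction, `E₀(K) = E(K)`
(Silverman, *AEC*, VII.2, remark after the proof of Prop. 2.1: `Ẽ_ns = Ẽ` and `E₀(K) = E(K)`).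
[cite: SilvermanAEC2009, VII.2, remark after Prop. 2.1, p. 190] -/
theorem goodReductionSubgroup_eq_top_of_hasGoodReduction [W.HasGoodReduction R] :
    W.goodReductionSubgroup R = ⊤ :=
  top_le_iff.mp fun P _ =>
    AddSubgroup.subset_closure (W.isNonsingularReductionPoint_of_hasGoodReduction R P)

/-- Discharge of the named fact `WeierstrassCurve.localTamagawaNumber_eq_one_of_hasGoodReduction`:
if the `R`-minimal model of `W` has good reduction then `c(W/K) = [E(K) : E₀(K)] = 1`
(Silverman, *AEC*, VII.2, remark after the proof of Prop. 2.1, p. 190: `E₀(K) = E(K)`; this is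
Step 1 of Tate's algorithm, reduction type `I₀`, `c = 1`: Silverman, *ATAEC*, IV.9, 9.4 Step 1,
after Tate, LNM 476 (1975)).
[cite: SilvermanAEC2009, VII.2, remark after Prop. 2.1, p. 190]
[cite: SilvermanATAEC1994, IV.9, Tate's algorithm 9.4, Step 1] -/
theorem localTamagawaNumber_eq_one_of_hasGoodReduction_holds :
    W.localTamagawaNumber_eq_one_of_hasGoodReduction R := by
  intro _
  exact AddSubgroup.index_eq_one.mpr
    ((W.minimal R).goodReductionSubgroup_eq_top_of_hasGoodReduction R)

end Local

end WeierstrassCurve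

end
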